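import Summits.SmoothPoincare4.SmoothPoincare4.Theorems.ConvexBisectionAcyclicBisectionExistsBeltPageLimit
import Mathlib.Analysis.Calculus.InverseFunctionTheorem.FDeriv
import HarnessLib

/-!
# The page clause at the deep belt circles, II: a deep belt point is not glued onto the binding
# (`c > 0`; node N2 = `node_BELT` of the NF4 design, verbatim)
(parent stub `stub_modelsOnFibred_of_reach`, line `modp-braid-orbits`, crux
`ConvexBisection.AcyclicBisectionExists`, item stmt-SmoothPoincare4-10508; wave 2, worker V4, lead c5)

Sequel of `…BeltPageLimit.lean` (`belt_nonneg`: at a deep belt point `bX.incl y₀ = D.jB k b₀ ∉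
range D.jA` of a fibred model datum, `w (Ψ y₀) = c · pageDir n k` with `c ≥ 0`).  Here `c > 0`
when `Ψ : ∂X → ∂ Base g` is moreover OPEN (e.g. the gluing diffeomorphism of `ModelsOnFibred`):

* §1 `exists_lamSq_gt` — uniform continuity at the attaching circle: a continuous `f : T → ℂ`
  constant `= e` on the circle `S = {|x_λ| = 1}` is `ε`-close to `e` on `{|x_λ|² > 1 − δ}`
  (compactness of `D⁴`: `|x_λ|²` attains a maximum `< 1` on the complement of the good open set).
* §2 `frequently_neg_ray` — at a BINDING point `p₀` of `∂ Base g` (`w = 0`, hence `‖x‖² > 4`,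
  `y ≠ 0`) the map `(w, rho) : ℝ⁴ → ℂ × ℝ` is a submersion (`∂_y w = 2y ≠ 0`, `∂_y rho = 0`,
  radial `∂_x rho = 2 eta' ‖x‖² > 0`: `hasDerivAt_w_lineY`, `hasDerivAt_rho_lineX_radial`), so by
  the open-mapping half of the inverse function theorem (`HasStrictFDerivAt.map_nhds_eq_of_surj`)
  every neighbourhood of `p₀` in `∂ Base g = {rho = 1/4}` contains points with `w` on any
  prescribed ray — in particular on the NEGATIVE ray `−ℝ_{>0} · pageDir n k`.
* §3 `eventually_sector` — near `y₀` every boundary point `y` is `D.jB k b` with `|b_λ|²` small,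
  hence either deep (`w (Ψ y) ∈ ℝ_{≥0} · pageDir n k`, part I) or glued to `D.jA (h k (α b))` with
  `h k (α b)` close to the attaching circle, where `w ≈ pageDir n k / 2` (§1); by the page clause
  `w (Ψ y) = c · v`, `c ≥ 0`, `‖v − pageDir n k / 2‖ < 1/4` — a sector around the page direction.
* §4 `belt_pos` — if `c = 0`, `Ψ y₀` is a binding point; `Ψ` open turns §3 into the same sector
  statement for all boundary points of `Base g` near `Ψ y₀`, contradicting §2 (`not_neg_ray`).
  Registered form `helper_belt_pageClause` = node N2 of the NF4 design verbatim; it is the `hbelt`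
  input of `pageClause_transfer_of_dichotomy` / `redecomposition_of_geometric_of_belt` (p134969).
Everything is proved; no definitions, no named facts.  References: A. A. Kosinski, *Differential
Manifolds* (1993), VI §6 [Kosinski1993]; R. E. Gompf, A. I. Stipsicz, *4-Manifolds and Kirby
Calculus* (1999), §8.2 [GompfStipsicz1999].
-/

noncomputable section

-- the prescribed namespace `Summit.<P>.<Sub>.…` duplicates `SmoothPoincare4` (P = Sub)
set_option linter.dupNamespace false

open scoped Manifold ContDiff Topology ComplexConjugate
open Set Function Filter Metric

namespace Summit.SmoothPoincare4.SmoothPoincare4.Theorems.AcyclicBisectionExists.ModpBraidOrbits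

open Literature.Topology.FourManifolds Literature.Topology.FourManifolds.LefschetzBase
open Literature.Topology.FourManifolds.HandleAttachingMap

namespace BeltPageClause

/-! ## §0 The sector around a page direction misses the negative ray -/

/-- A non-negative real multiple of a vector `v` within `1/4` of `d/2` (`‖d‖ = 1`) is never a
negative multiple `−τ d`, `τ > 0`, of `d`. [folklore] -/
theorem not_neg_ray {d v : ℂ} (hd : ‖d‖ = 1) {c τ : ℝ} (hc : 0 ≤ c) (hτ : 0 < τ)
    (hv : ‖v - d / 2‖ < 1 / 4) (h : (c : ℂ) * v = -((τ : ℂ) * d)) : False := by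
  have h1 : ‖(c : ℂ) * v - (c : ℂ) * (d / 2)‖ ≤ c * (1 / 4) := by
    rw [← mul_sub, norm_mul, Complex.norm_real, Real.norm_eq_abs, abs_of_nonneg hc]
    exact mul_le_mul_of_nonneg_left hv.le hc
  have h2 : (c : ℂ) * v - (c : ℂ) * (d / 2) = -(((τ + c / 2 : ℝ) : ℂ) * d) := by
    rw [h]; push_cast; ring
  rw [h2, norm_neg, norm_mul, hd, mul_one, Complex.norm_real, Real.norm_eq_abs,
    abs_of_nonneg (by linarith)] at h1
  linarith

/-! ## §1 Uniform closeness to the value on the attaching circle -/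

/-- **Uniform continuity at the attaching circle.**  A continuous `f : T → ℂ` on Kosinski's tube
which is constant `= e` on the attaching circle `S = {|x_λ| = 1}` is `ε`-close to `e` on a
neighbourhood `{|x_λ|² > 1 − δ}` of `S` (on the compact complement in `D⁴` of the open set where
`‖f − e‖ < ε`, the continuous `|x_λ|²` attains its maximum, which is `< 1`). [folklore] -/
theorem exists_lamSq_gt {f : ↥(handleTube 3 2) → ℂ} (hf : Continuous f) {e : ℂ}
    (he : ∀ θ, f (coreTubePt θ) = e) {ε : ℝ} (hε : 0 < ε) :
    ∃ δ : ℝ, 0 < δ ∧ ∀ t : ↥(handleTube 3 2),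
      1 - δ < lamSq 2 (((t : Metric.closedBall (0 : EuclideanSpace ℝ (Fin 4)) 1) :
        EuclideanSpace ℝ (Fin 4))) → ‖f t - e‖ < ε := by
  set U : Set ↥(handleTube 3 2) := f ⁻¹' ball e ε with hU
  have hUo : IsOpen U := isOpen_ball.preimage hf
  set U' : Set (Metric.closedBall (0 : EuclideanSpace ℝ (Fin 4)) 1) := Subtype.val '' U with hU'
  have hU'o : IsOpen U' := (handleTube 3 2).isOpen.isOpenMap_subtype_val U hUo
  have hgood : ∀ t : ↥(handleTube 3 2),
      (t : Metric.closedBall (0 : EuclideanSpace ℝ (Fin 4)) 1) ∈ U' → ‖f t - e‖ < ε := by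
    rintro t ⟨t', ht', he'⟩
    rw [Subtype.ext he'] at ht'
    rw [← dist_eq_norm]
    exact ht'
  have hK : IsCompact U'ᶜ := hU'o.isClosed_compl.isCompact
  rcases (U'ᶜ).eq_empty_or_nonempty with hKe | hKne
  · refine ⟨1, one_pos, fun t _ => hgood t ?_⟩
    rw [Set.compl_empty_iff.1 hKe]
    exact mem_univ _
  · have hφ : Continuous fun v : Metric.closedBall (0 : EuclideanSpace ℝ (Fin 4)) 1 =>
        lamSq 2 (v : EuclideanSpace ℝ (Fin 4)) :=
      (continuous_lamSq 2).comp continuous_subtype_val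
    obtain ⟨v₀, hv₀K, hmax⟩ := hK.exists_isMaxOn hKne hφ.continuousOn
    have hM1 : lamSq 2 (v₀ : EuclideanSpace ℝ (Fin 4)) < 1 := by
      refine lt_of_le_of_ne (lamSq_le_one (mem_closedBall_zero_iff.1 v₀.2)) fun h1 => hv₀K ?_
      have hvT : v₀ ∈ handleTube 3 2 := attachingSphereSet_subset_handleTube 3 2 h1
      obtain ⟨θ, hθ⟩ := exists_coreTubePt_eq (y := ⟨v₀, hvT⟩) h1
      refine ⟨⟨v₀, hvT⟩, ?_, rfl⟩
      rw [← hθ]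
      show f (coreTubePt θ) ∈ ball e ε
      rw [he θ]
      exact mem_ball_self hε
    refine ⟨1 - lamSq 2 (v₀ : EuclideanSpace ℝ (Fin 4)), by linarith, fun t ht => hgood t ?_⟩
    by_contra hnot
    have hle := (isMaxOn_iff.1 hmax) _ hnot
    linarith

/-! ## §2 Binding points of `∂ Base g`: every neighbourhood meets every ray -/

/-- **At a binding point the boundary of the base reaches the negative ray of every page.**  If
`z₀ ∈ ∂ Base g` has `w = 0` then every neighbourhood of `z₀` in `∂ Base g` contains points with
`w = −τ d`, `τ > 0` (`‖d‖ = 1` arbitrary): `(w, rho) : ℝ⁴ → ℂ × ℝ` is a submersion at the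
ambient point `p₀` (`‖x‖² > 4`, `y ≠ 0` there; `∂_y w = 2y`, `∂_y rho = 0`,
`∂_{x, radial} rho = 2 eta'(‖x‖²) ‖x‖² > 0`), hence open at `p₀`
(`HasStrictFDerivAt.map_nhds_eq_of_surj`), and `∂ Base g = {rho = 1/4}` carries the topology
induced from `ℝ⁴`. [folklore] -/
theorem frequently_neg_ray (g : ℕ) {z₀ : (bBase g).carrier}
    (hz : w g ((bBase g).incl z₀).1 = 0) {d : ℂ} (hd : ‖d‖ = 1) :
    ∃ᶠ z in 𝓝 z₀, ∃ τ : ℝ, 0 < τ ∧ w g ((bBase g).incl z).1 = -((τ : ℂ) * d) := by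
  set p₀ : EuclideanSpace ℝ (Fin 4) := ((bBase g).incl z₀).1 with hp₀
  have hrho : rho g p₀ = 1 / 4 := RegularSublevel.apply_incl_boundary (isRegularLevel_rho g) z₀
  -- the binding point: `‖x‖² > 4`, `y ≠ 0`
  have hx : 4 < ‖cx p₀‖ ^ 2 := by
    by_contra hle
    have h0 : rho g p₀ = 0 := rho_eq_zero_of_w_eq_zero g hz (not_lt.1 hle)
    rw [h0] at hrho
    norm_num at hrho
  have hy : cy p₀ ≠ 0 := by
    intro hy0
    have h1 : cx p₀ ^ (2 * g + 1) = -1 := by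
      have h0 : w g p₀ = 0 := hz
      rw [w, Phi, hy0] at h0
      linear_combination -h0
    have h2 : ‖cx p₀‖ ^ (2 * g + 1) = 1 := by rw [← norm_pow, h1, norm_neg, norm_one]
    have h3 : ‖cx p₀‖ = 1 := (pow_eq_one_iff_of_nonneg (norm_nonneg _) (by omega)).1 h2
    rw [h3] at hx
    norm_num at hx
  -- directional derivatives of `w` and `rho` at `p₀`
  set R : ℝ := deriv eta (‖cx p₀‖ ^ 2) * (2 * ‖cx p₀‖ ^ 2) with hR
  have hRpos : 0 < R := mul_pos (deriv_eta_pos hx) (by positivity)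
  set A : ℂ := -((2 * g + 1 : ℕ) * cx p₀ ^ (2 * g) * cx p₀) with hA
  have hdw : Differentiable ℝ (w g) := (contDiff_w g).differentiable (by simp)
  have hdr : Differentiable ℝ (rho g) := (contDiff_rho g).differentiable (by simp)
  have hline : ∀ {f : EuclideanSpace ℝ (Fin 4) → ℂ}, Differentiable ℝ f →
      ∀ v : EuclideanSpace ℝ (Fin 4),
        HasDerivAt (fun t : ℝ => f (p₀ + t • v)) (fderiv ℝ f p₀ v) 0 := by
    intro f hf v
    have hl : HasDerivAt (fun t : ℝ => p₀ + t • v) v 0 := by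
      have h := ((hasDerivAt_id (0 : ℝ)).smul_const v).const_add p₀
      rwa [one_smul] at h
    have h := (hf (p₀ + (0 : ℝ) • v)).hasFDerivAt.comp_hasDerivAt (0 : ℝ) hl
    rwa [zero_smul, add_zero] at h
  have hwY : ∀ c : ℂ, fderiv ℝ (w g) p₀ (mk 0 c) = 2 * c * cy p₀ := fun c =>
    (hline hdw (mk 0 c)).unique (hasDerivAt_w_lineY g p₀ c)
  have hwX : fderiv ℝ (w g) p₀ (mk (cx p₀) 0) = A :=
    (hline hdw (mk (cx p₀) 0)).unique (hasDerivAt_w_lineX g p₀ (cx p₀))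
  have hrY : ∀ c : ℂ, fderiv ℝ (rho g) p₀ (mk 0 c) = 0 := by
    intro c
    have h1 := hasDerivAt_norm_sq_comp (hasDerivAt_w_lineY g p₀ c)
    have h2 : HasDerivAt (fun t : ℝ => eta (‖cx (lineY p₀ c t)‖ ^ 2)) 0 0 := by
      have hfun : (fun t : ℝ => eta (‖cx (lineY p₀ c t)‖ ^ 2)) = fun _ => eta (‖cx p₀‖ ^ 2) := by
        funext t; rw [cx_lineY]
      rw [hfun]
      exact hasDerivAt_const _ _
    have h := h1.add h2
    rw [lineY_zero, hz, map_zero, zero_mul, Complex.zero_re, mul_zero, add_zero] at h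
    exact (hasDerivAt_comp_line hdr p₀ (mk 0 c)).unique h
  have hrX : fderiv ℝ (rho g) p₀ (mk (cx p₀) 0) = R :=
    (hasDerivAt_comp_line hdr p₀ (mk (cx p₀) 0)).unique (hasDerivAt_rho_lineX_radial g p₀ hz hx)
  -- `(w, rho)` is a submersion at `p₀`
  set L : EuclideanSpace ℝ (Fin 4) →L[ℝ] ℂ × ℝ :=
    (fderiv ℝ (w g) p₀).prod (fderiv ℝ (rho g) p₀) with hL
  have hstrict : HasStrictFDerivAt (fun p => (w g p, rho g p)) L p₀ :=
    ((contDiff_w g).contDiffAt.hasStrictFDerivAt (by simp)).prodMk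
      ((contDiff_rho g).contDiffAt.hasStrictFDerivAt (by simp))
  have hsurj : Function.Surjective L := by
    intro q
    refine ⟨(q.2 / R) • mk (cx p₀) 0 + mk 0 ((q.1 - ((q.2 / R : ℝ) : ℂ) * A) / (2 * cy p₀)), ?_⟩
    have h2y : (2 : ℂ) * cy p₀ ≠ 0 := mul_ne_zero two_ne_zero hy
    show L _ = q
    rw [hL, ContinuousLinearMap.prod_apply, map_add, map_add, map_smul, map_smul, hwY, hwX, hrY,
      hrX]
    refine Prod.ext ?_ ?_
    · show (q.2 / R) • A + 2 * ((q.1 - ((q.2 / R : ℝ) : ℂ) * A) / (2 * cy p₀)) * cy p₀ = q.1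
      rw [Complex.real_smul, mul_div_assoc', div_mul_eq_mul_div, mul_assoc, mul_comm _ (cy p₀),
        ← mul_assoc, mul_div_assoc]
      rw [show (2 : ℂ) * cy p₀ * ((q.1 - ((q.2 / R : ℝ) : ℂ) * A) / (2 * cy p₀)) =
        q.1 - ((q.2 / R : ℝ) : ℂ) * A from mul_div_cancel₀ _ h2y]
      ring
    · show (q.2 / R) • R + (0 : ℝ) = q.2
      rw [smul_eq_mul, div_mul_cancel₀ _ hRpos.ne', add_zero]
  have hmap : map (fun p => (w g p, rho g p)) (𝓝 p₀) = 𝓝 (w g p₀, rho g p₀) :=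
    hstrict.map_nhds_eq_of_surj (LinearMap.range_eq_top.2 hsurj)
  rw [hz, hrho] at hmap
  -- neighbourhoods of `z₀` in `∂ Base g` are traces of neighbourhoods of `p₀` in `ℝ⁴`
  have hΦ : Topology.IsEmbedding fun z : (bBase g).carrier => ((bBase g).incl z).1 :=
    Topology.IsEmbedding.subtypeVal.comp (bBase g).isSmoothEmbedding.isEmbedding
  rw [Filter.frequently_iff]
  intro N hN
  rw [hΦ.nhds_eq_comap z₀] at hN
  obtain ⟨N', hN', hsub⟩ := hN
  have himg : (fun p => (w g p, rho g p)) '' N' ∈ 𝓝 ((0 : ℂ), (1 / 4 : ℝ)) := by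
    rw [← hmap]; exact image_mem_map hN'
  obtain ⟨ε, hε, hball⟩ := Metric.mem_nhds_iff.1 himg
  have hQ : (-(((ε / 2 : ℝ) : ℂ) * d), (1 / 4 : ℝ)) ∈ ball ((0 : ℂ), (1 / 4 : ℝ)) ε := by
    rw [mem_ball, Prod.dist_eq, dist_self, dist_zero_right, norm_neg, norm_mul, hd, mul_one,
      Complex.norm_real, Real.norm_eq_abs, abs_of_pos (half_pos hε),
      max_eq_left (half_pos hε).le]
    linarith
  obtain ⟨p, hpN', hpQ⟩ := hball hQ
  have hwp : w g p = -(((ε / 2 : ℝ) : ℂ) * d) := congrArg Prod.fst hpQ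
  have hrp : rho g p = 1 / 4 := congrArg Prod.snd hpQ
  -- the boundary point of `Base g` at `p`
  let P : Base g := RegularSublevel.mk (isRegularLevel_rho g) p hrp.le
  have hPb : P ∈ (𝓡∂ 4).boundary (Base g) := (RegularSublevel.mem_boundary_iff _ P).2 hrp
  exact ⟨⟨P, hPb⟩, hsub (show p ∈ N' from hpN'), ε / 2, half_pos hε, hwp⟩

/-! ## §3 Near a deep belt point `w ∘ Ψ` stays in a sector around the page direction -/

section Belt

universe u

variable {g n : ℕ} {h : Fin n → HandleAttachingMap 3 2 (Base g)}
  {X : Type u} [TopologicalSpace X] [ChartedSpace (EuclideanHalfSpace 4) X]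

/-- **The sector property near a deep belt point.**  With the data of `belt_nonneg` (attaching
circle of `h k` in `page g (pageDir n k)`, continuous `Ψ` page preserving on the seam) and a deep
belt point `bX.incl y₀ = D.jB k b₀ ∉ range D.jA`: for all `y` near `y₀`,
`w (Ψ y) = c · v` with `c ≥ 0` and `‖v − pageDir n k / 2‖ < 1/4` — such `y` are `D.jB k b` with
`|b_λ|²` small, hence deep (`belt_nonneg`) or glued to `D.jA (h k (α b))` with `h k (α b)` close
to the attaching circle (`exists_lamSq_gt`), where the page clause applies. [cite: Kosinski1993, VI §6] -/
theorem eventually_sector (D : MultiAttachmentData h (𝓡∂ 4) X) (bX : BoundaryData (𝓡∂ 4) X (𝓡 3))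
    {Ψ : bX.carrier → (bBase g).carrier} (hΨ : Continuous Ψ) {k : Fin n}
    (hk : ∀ θ, (h k).attachingCircle θ ∈ page g (pageDir n k))
    (hpage : ∀ (y : bX.carrier) (a : ↥(coresComplement h)), bX.incl y = D.jA a →
      ∃ c : ℝ, 0 < c ∧ w g ((bBase g).incl (Ψ y)).1 = (c : ℂ) * w g (a : Base g).1)
    {y₀ : bX.carrier} {b₀ : ↥(beltPiece 3 2)} (hy₀ : bX.incl y₀ = D.jB k b₀)
    (hdeep : bX.incl y₀ ∉ range D.jA) :
    ∀ᶠ y in 𝓝 y₀, ∃ (c : ℝ) (v : ℂ), 0 ≤ c ∧ ‖v - pageDir n k / 2‖ < 1 / 4 ∧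
      w g ((bBase g).incl (Ψ y)).1 = (c : ℂ) * v := by
  have hb0 := lamSq_eq_zero_of_not_mem_range_jA D k b₀ (hy₀ ▸ hdeep)
  -- uniform closeness of `w ∘ h k` to `pageDir n k / 2` near the attaching circle
  have hf : Continuous fun t : ↥(handleTube 3 2) => w g ((h k).toFun t).1 :=
    (contDiff_w g).continuous.comp (continuous_subtype_val.comp (h k).continuous)
  obtain ⟨δ, hδ, hclose⟩ :=
    exists_lamSq_gt hf (e := pageDir n k / 2) (fun θ => (hk θ).2) (by norm_num : (0 : ℝ) < 1 / 4)
  -- eventually `bX.incl y = D.jB k b` with `|b_λ|² < δ`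
  set O : Set X := D.jB k '' {b : ↥(beltPiece 3 2) |
    lamSq 2 (((b : Metric.closedBall (0 : EuclideanSpace ℝ (Fin 4)) 1) :
      EuclideanSpace ℝ (Fin 4))) < δ} with hO
  have hOo : IsOpen O := D.isOpenMap_jB k _ (isOpen_lt
    ((continuous_lamSq 2).comp (continuous_subtype_val.comp continuous_subtype_val))
    continuous_const)
  have hy₀O : bX.incl y₀ ∈ O := ⟨b₀, by rw [mem_setOf_eq, hb0]; exact hδ, hy₀.symm⟩
  filter_upwards [bX.continuous_incl.continuousAt.eventually_mem (hOo.mem_nhds hy₀O)] with y hyO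
  obtain ⟨b, hbδ, hyb⟩ := hyO
  have hbδ' : lamSq 2 (((b : Metric.closedBall (0 : EuclideanSpace ℝ (Fin 4)) 1) :
      EuclideanSpace ℝ (Fin 4))) < δ := hbδ
  by_cases hb : lamSq 2 (((b : Metric.closedBall (0 : EuclideanSpace ℝ (Fin 4)) 1) :
      EuclideanSpace ℝ (Fin 4))) = 0
  · -- a deep point: part I
    have hnot : bX.incl y ∉ range D.jA := by
      rintro ⟨a, ha⟩
      exact ((D.glue k a b).1 (ha.trans hyb.symm)).lamSq_ne_zero hb
    obtain ⟨c, hc, hcw⟩ := belt_nonneg D bX hΨ hk hpage hyb.symm hnot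
    refine ⟨2 * c, pageDir n k / 2, by positivity, by rw [sub_self, norm_zero]; norm_num, ?_⟩
    rw [hcw]
    push_cast
    ring
  · -- a glued point: the page clause at `h k (α b)`
    have hb1 : lamSq 2 (((b : Metric.closedBall (0 : EuclideanSpace ℝ (Fin 4)) 1) :
        EuclideanSpace ℝ (Fin 4))) ≠ 1 := b.2
    set t : ↥(handleTube 3 2) :=
      handleInversionPt (b : Metric.closedBall (0 : EuclideanSpace ℝ (Fin 4)) 1) hb hb1 with ht_def
    have ht1 : lamSq 2 (((t : Metric.closedBall (0 : EuclideanSpace ℝ (Fin 4)) 1) :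
        EuclideanSpace ℝ (Fin 4))) ≠ 1 := (handleInversion_mem hb hb1).2.2
    have h0' : 0 < lamSq 2 (((b : Metric.closedBall (0 : EuclideanSpace ℝ (Fin 4)) 1) :
        EuclideanSpace ℝ (Fin 4))) := lt_of_le_of_ne (lamSq_nonneg 2 _) (Ne.symm hb)
    have h1' : lamSq 2 (((b : Metric.closedBall (0 : EuclideanSpace ℝ (Fin 4)) 1) :
        EuclideanSpace ℝ (Fin 4))) < 1 :=
      lt_of_le_of_ne (lamSq_le_one (mem_closedBall_zero_iff.1 b.1.2)) hb1
    have htlam : lamSq 2 (((t : Metric.closedBall (0 : EuclideanSpace ℝ (Fin 4)) 1) :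
        EuclideanSpace ℝ (Fin 4))) = 1 - lamSq 2 (((b : Metric.closedBall
          (0 : EuclideanSpace ℝ (Fin 4)) 1) : EuclideanSpace ℝ (Fin 4))) :=
      lamSq_handleInversion h0' h1'.le
    have hglue := jA_apply_eq_jB D k t ht1
    have hbb : (⟨⟨handleInversion 2 (((t : Metric.closedBall (0 : EuclideanSpace ℝ (Fin 4)) 1) :
        EuclideanSpace ℝ (Fin 4))), (handleInversion_mem t.2 ht1).1⟩,
        (handleInversion_mem t.2 ht1).2.2⟩ : ↥(beltPiece 3 2)) = b := by
      apply Subtype.ext; apply Subtype.ext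
      show handleInversion 2 (handleInversion 2 _) = _
      exact handleInversion_handleInversion h0' h1'
    rw [hbb] at hglue
    obtain ⟨c, hc, hcw⟩ := hpage y _ (hglue.trans hyb).symm
    exact ⟨c, w g ((h k).toFun t).1, hc.le, hclose t (by rw [htlam]; linarith), hcw⟩

/-! ## §4 The factor is positive: a deep belt point is not glued onto the binding -/

/-- **The page clause at the deep belt circles, `c > 0`.**  With the data of `belt_nonneg` and
`Ψ` moreover an OPEN map (e.g. a homeomorphism `∂X ≅ ∂ Base g`): a deep belt point
`bX.incl y₀ = D.jB k b₀ ∉ range D.jA` has `w (Ψ y₀) = c · pageDir n k` with `c > 0`.  By part I,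
`c ≥ 0`; if `c = 0` then `Ψ y₀` is a binding point, the sector property (`eventually_sector`)
transported by the open map `Ψ` holds at all points of `∂ Base g` near `Ψ y₀`, and contradicts
`frequently_neg_ray`. [cite: Kosinski1993, VI §6] -/
theorem belt_pos (D : MultiAttachmentData h (𝓡∂ 4) X) (bX : BoundaryData (𝓡∂ 4) X (𝓡 3))
    {Ψ : bX.carrier → (bBase g).carrier} (hΨ : Continuous Ψ) (hΨo : IsOpenMap Ψ) {k : Fin n}
    (hk : ∀ θ, (h k).attachingCircle θ ∈ page g (pageDir n k))
    (hpage : ∀ (y : bX.carrier) (a : ↥(coresComplement h)), bX.incl y = D.jA a →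
      ∃ c : ℝ, 0 < c ∧ w g ((bBase g).incl (Ψ y)).1 = (c : ℂ) * w g (a : Base g).1)
    {y₀ : bX.carrier} {b₀ : ↥(beltPiece 3 2)} (hy₀ : bX.incl y₀ = D.jB k b₀)
    (hdeep : bX.incl y₀ ∉ range D.jA) :
    ∃ c : ℝ, 0 < c ∧ w g ((bBase g).incl (Ψ y₀)).1 = (c : ℂ) * pageDir n k := by
  obtain ⟨c, hc, hcw⟩ := belt_nonneg D bX hΨ hk hpage hy₀ hdeep
  rcases hc.lt_or_eq with hc' | hc'
  · exact ⟨c, hc', hcw⟩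
  exfalso
  rw [← hc', Complex.ofReal_zero, zero_mul] at hcw
  have hfreq := frequently_neg_ray g hcw (norm_pageDir n k)
  have hev := eventually_sector D bX hΨ hk hpage hy₀ hdeep
  have hev' : ∀ᶠ z in 𝓝 (Ψ y₀), ∃ y, Ψ y = z ∧ ∃ (c : ℝ) (v : ℂ), 0 ≤ c ∧
      ‖v - pageDir n k / 2‖ < 1 / 4 ∧ w g ((bBase g).incl (Ψ y)).1 = (c : ℂ) * v := by
    obtain ⟨U, hU, hUo, hyU⟩ := eventually_nhds_iff.1 hev
    filter_upwards [hΨo.image_mem_nhds (hUo.mem_nhds hyU)] with z hz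
    obtain ⟨y, hyU', rfl⟩ := hz
    exact ⟨y, rfl, hU y hyU'⟩
  obtain ⟨z, ⟨τ, hτ, hz⟩, y, rfl, c', v, hc'0, hv, hyw⟩ := (hfreq.and_eventually hev').exists
  exact not_neg_ray (norm_pageDir n k) hc'0 hτ hv (hyw.symm.trans hz)

end Belt

end BeltPageClause

open BeltPageClause

/-! ## §5 Registered helper: node N2 (BELT) of the NF4 design, verbatim -/

/-- **Registered helper `helper_belt_pageClause` = node N2 (`node_BELT`) of the NF4 design (wave 2,
lead c5): in a fibred model datum `(X, h, D, bX, Ψ)` of a Lefschetz link `l` (page clause on the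
seam), every DEEP BELT point of the seam — `bX.incl y = D.jB k b ∉ range D.jA` — is glued to the
page of the `k`-th letter: `w (Ψ y) = c · pageDir l.length k` with `c > 0`.**  This is the `hbelt`
input of `pageClause_transfer_of_dichotomy` / `redecomposition_of_geometric_of_belt` (p134969).
[cite: Kosinski1993, VI §6] -/
theorem helper_belt_pageClause :
    ∀ (g : ℕ) (l : Literature.GroupTheory.CombinatorialGroupTheory.SignedHurwitz.IntWord g) (X :
      Type) [TopologicalSpace X] [T2Space X] [SecondCountableTopology X] [CompactSpace X]
      [ChartedSpace (EuclideanHalfSpace 4) X] [IsManifold (𝓡∂ 4) ∞ X] (h : Fin l.length →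
      Literature.Topology.FourManifolds.HandleAttachingMap 3 2
      (Literature.Topology.FourManifolds.LefschetzBase.Base g)) (D :
      Literature.Topology.FourManifolds.HandleAttachingMap.MultiAttachmentData h (𝓡∂ 4) X) (bX :
      Literature.Topology.FourManifolds.BoundaryData (𝓡∂ 4) X (𝓡 3)) (Ψ : bX.carrier ≃ₘ⟮𝓡 3, 𝓡 3⟯
      (Literature.Topology.FourManifolds.LefschetzBase.bBase g).carrier),
      Literature.Topology.FourManifolds.LefschetzBase.IsLefschetzLink g l h → (∀ (y : bX.carrier)
      (a : ↥(Literature.Topology.FourManifolds.HandleAttachingMap.coresComplement h)), bX.incl y =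
      D.jA a → ∃ c : ℝ, 0 < c ∧ Literature.Topology.FourManifolds.LefschetzBase.w g
      ((Literature.Topology.FourManifolds.LefschetzBase.bBase g).incl (Ψ y)).1 = (c : ℂ) *
      Literature.Topology.FourManifolds.LefschetzBase.w g (a :
      Literature.Topology.FourManifolds.LefschetzBase.Base g).1) → ∀ (y : bX.carrier) (k : Fin
      l.length) (b : ↥(Literature.Topology.FourManifolds.beltPiece 3 2)), bX.incl y = D.jB k b →
      bX.incl y ∉ Set.range D.jA → ∃ c : ℝ, 0 < c ∧
      Literature.Topology.FourManifolds.LefschetzBase.w g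
      ((Literature.Topology.FourManifolds.LefschetzBase.bBase g).incl (Ψ y)).1 = (c : ℂ) *
      Literature.Topology.FourManifolds.LefschetzBase.pageDir l.length k :=
  fun _ _ _ _ _ _ _ _ _ _ D bX Ψ hl hpage _ k _ hy hdeep =>
    belt_pos D bX Ψ.continuous Ψ.toHomeomorph.isOpenMap (hl.mem_page k) hpage hy hdeep

end Summit.SmoothPoincare4.SmoothPoincare4.Theorems.AcyclicBisectionExists.ModpBraidOrbits

end
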